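import Mathlib
import Summits.Parity.BatemanHorn.Theorems.PolynomialMobiusPolyMobiusTailStubPairMiddleBoxes

/-!
# P2 `stub_pair_middle` — the short range `m ≤ M₀` (pure counting)

STATUS: complete (no sorries); single file; lands as
`Summits/Parity/BatemanHorn/Theorems/PolynomialMobiusPolyMobiusTailStubPairMiddleSmallM.lean`.

Auxiliary stub `stub_pair_middle_smallm` of the line `eta-free-multilinear-window` (crux
`PolyMobiusTail`), supporting the middle-range stub `stub_pair_middle` (dispersion for the `k = 2`
linear window).  In the `(d₀, d₁, m)`-parametrisation of the one-sided middle sum of a pair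
`(q₀X + a₀, q₁X + a₁)` (`n = (d₁m − a₁)/q₁`), the part `m ≤ M₀` of the TRUE triple sum
(conditions C1: `q₁ ∣ d₁m − a₁`; C3: `1 ≤ n ≤ x`; C2⁺: `1 ≤ q₀n + a₀`; C2: `d₀ ∣ q₀n + a₀`; the
window `x^{1-η} < d₀d₁ ≤ x^{1+θ}`; C5: `x^{σ₁} < d₀ ≤ x^{σ₂}`) weighted by
`μ(d₀) log d₀ · μ(d₁) log d₁` is at most `(1 + log Xb)²` times the number of TRUE configurations,
and `(d₀, d₁, m) ↦ (n, d₀, d₁)` injects the TRUE configurations into the divisor pairs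
`d₀ ∣ (q₀n + a₀)⁺`, `d₁ ∣ (q₁n + a₁)⁺` with `1 ≤ n ≤ ⌊M₀ x^{1+θ-σ₁}⌋₊ + |a₁|`
(`d₁ < x^{1+θ-σ₁}` by the window and C5, and `q₁n + a₁ = d₁m ≤ d₁M₀`).
Everything here is elementary counting; no analytic input.
-/

open scoped BigOperators
open Filter Finset Polynomial Asymptotics

namespace Summit.Parity.BatemanHorn.Theorems.PolyMobiusTail.EtaFreeWindow

/-- Abstract weighted-count bound: if `|w| ≤ L` on the configurations of `s` satisfying `T`, the
`T`-restricted sum of `w` over `s` is at most `L · #{T}` in absolute value. -/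
theorem abs_sum_ite_le_mul_card_filter {ι : Type*} (s : Finset ι) (T : ι → Prop)
    [DecidablePred T] (w : ι → ℝ) {L : ℝ} (hw : ∀ i ∈ s, T i → |w i| ≤ L) :
    |∑ i ∈ s, (if T i then w i else 0)| ≤ L * ((s.filter T).card : ℝ) := by
  refine (Finset.abs_sum_le_sum_abs _ _).trans ?_
  have key : ∀ i ∈ s, |(if T i then w i else 0)| ≤ if T i then L else 0 := by
    intro i hi
    split_ifs with h
    · exact hw i hi h
    · rw [abs_zero]
  refine (Finset.sum_le_sum key).trans ?_
  rw [← Finset.sum_filter, Finset.sum_const, nsmul_eq_mul, mul_comm]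

/-- Abstract weighted-count bound with a change of variables: if moreover a map `f` sends the
`T`-configurations of `s` injectively into a finset `t`, the `T`-restricted sum of `w` over `s`
is at most `L · #t` in absolute value. -/
theorem abs_sum_ite_le_mul_card_of_injOn {ι κ : Type*} (s : Finset ι) (t : Finset κ)
    (T : ι → Prop) [DecidablePred T] (w : ι → ℝ) {L : ℝ} (hL : 0 ≤ L)
    (hw : ∀ i ∈ s, T i → |w i| ≤ L) (f : ι → κ) (hf : ∀ i ∈ s, T i → f i ∈ t)
    (hinj : ∀ i ∈ s, T i → ∀ j ∈ s, T j → f i = f j → i = j) :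
    |∑ i ∈ s, (if T i then w i else 0)| ≤ L * (t.card : ℝ) := by
  refine (abs_sum_ite_le_mul_card_filter s T w hw).trans (mul_le_mul_of_nonneg_left ?_ hL)
  have h : (s.filter T).card ≤ t.card := by
    refine Finset.card_le_card_of_injOn f ?_ ?_
    · intro i hi
      simp only [Finset.coe_filter, Set.mem_setOf_eq] at hi
      exact Finset.mem_coe.2 (hf i hi.1 hi.2)
    · intro i hi j hj hij
      simp only [Finset.coe_filter, Set.mem_setOf_eq] at hi hj
      exact hinj i hi.1 hi.2 j hj.1 hj.2 hij
  exact_mod_cast h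

/-- The divisor-pair count: the number of `(n, d₀, d₁)` with `n ∈ [1, N]`, `d₀ ∣ (q₀n + a₀)⁺`,
`d₁ ∣ (q₁n + a₁)⁺` (as a sigma finset) is `∑_{n=1}^{N} τ((q₀n + a₀)⁺) τ((q₁n + a₁)⁺)`. -/
theorem card_sigma_divisors_pair (q₀ a₀ q₁ a₁ : ℤ) (N : ℕ) :
    ((Finset.Icc 1 N).sigma fun n : ℕ =>
        ((q₀ * n + a₀).toNat).divisors ×ˢ ((q₁ * n + a₁).toNat).divisors).card =
      ∑ n ∈ Finset.Icc 1 N,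
        ((q₀ * n + a₀).toNat).divisors.card * ((q₁ * n + a₁).toNat).divisors.card := by
  rw [Finset.card_sigma]
  simp only [Finset.card_product]

/-- **SMALLM (pure counting).**  For pair data `q₀,a₀,q₁,a₁` (`qᵢ ≥ 1`), exponents `σ₁,σ₂,θ,η`,
`x ≥ 1`, a bound `Xb` and `M₀`, the part `m ≤ M₀` of the one-sided middle `(d₀,d₁,m)`-sum
(conditions C1, C3, C2⁺, C2, window, C5) weighted by `μ(d₀) log d₀ · μ(d₁) log d₁` has absolute
value at most `(1 + log Xb)² · ∑_{1 ≤ n ≤ N} τ((q₀n + a₀)⁺) τ((q₁n + a₁)⁺)` with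
`N = ⌊M₀ x^{1+θ-σ₁}⌋₊ + |a₁|`. -/
theorem stub_pair_middle_smallm :
    ∀ (q₀ a₀ q₁ a₁ : ℤ) (σ₁ σ₂ θ η : ℝ) (x Xb M₀ : ℕ), 0 < q₀ → 0 < q₁ → 1 ≤ x →
      |∑ d₀ ∈ Finset.Icc 1 Xb, ∑ d₁ ∈ Finset.Icc 1 Xb, ∑ m ∈ Finset.Icc 1 M₀,
          (if ((d₁ : ℤ) * m - a₁) % q₁ = 0 ∧
              (1 ≤ ((d₁ : ℤ) * m - a₁) / q₁ ∧ ((d₁ : ℤ) * m - a₁) / q₁ ≤ x) ∧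
              (1 ≤ q₀ * (((d₁ : ℤ) * m - a₁) / q₁) + a₀ ∧ (d₀ : ℤ) ∣ q₀ * (((d₁ : ℤ) * m - a₁) / q₁) + a₀) ∧
              ((x : ℝ) ^ (1 - η) < (d₀ : ℝ) * d₁ ∧ (d₀ : ℝ) * d₁ ≤ (x : ℝ) ^ (1 + θ) ∧
                ((x : ℝ) ^ σ₁ < (d₀ : ℝ) ∧ (d₀ : ℝ) ≤ (x : ℝ) ^ σ₂)) then
            ((ArithmeticFunction.moebius d₀ : ℝ) * Real.log d₀) *
              ((ArithmeticFunction.moebius d₁ : ℝ) * Real.log d₁) else 0)| ≤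
      (1 + Real.log Xb) ^ 2 *
        ∑ n ∈ Finset.Icc 1 (⌊(M₀ : ℝ) * (x : ℝ) ^ (1 + θ - σ₁)⌋₊ + a₁.natAbs),
          ((((q₀ * n + a₀).toNat).divisors.card : ℕ) : ℝ) * ((((q₁ * n + a₁).toNat).divisors.card : ℕ) : ℝ) := by
  intro q₀ a₀ q₁ a₁ σ₁ σ₂ θ η x Xb M₀ _hq₀ hq₁ hx
  rw [sum_sum_sum_eq_sum_product]
  set N : ℕ := ⌊(M₀ : ℝ) * (x : ℝ) ^ (1 + θ - σ₁)⌋₊ + a₁.natAbs with hN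
  have hL : 0 ≤ (1 + Real.log Xb) ^ 2 := sq_nonneg _
  have hxpos : (0 : ℝ) < x := by exact_mod_cast hx
  have hxσ : (0 : ℝ) < (x : ℝ) ^ σ₁ := Real.rpow_pos_of_pos hxpos _
  -- the target finset of the change of variables `(d₀, d₁, m) ↦ (n, d₀, d₁)`
  set tS : Finset (Σ _ : ℕ, ℕ × ℕ) := (Finset.Icc 1 N).sigma fun n : ℕ =>
    ((q₀ * n + a₀).toNat).divisors ×ˢ ((q₁ * n + a₁).toNat).divisors with htS
  have hcard : ((tS.card : ℕ) : ℝ) = ∑ n ∈ Finset.Icc 1 N,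
      ((((q₀ * n + a₀).toNat).divisors.card : ℕ) : ℝ) *
        ((((q₁ * n + a₁).toNat).divisors.card : ℕ) : ℝ) := by
    rw [htS, card_sigma_divisors_pair, Nat.cast_sum]
    refine Finset.sum_congr rfl fun n _ => ?_
    rw [Nat.cast_mul]
  rw [← hcard]
  refine abs_sum_ite_le_mul_card_of_injOn _ tS _ _ hL ?_
    (fun c : (ℕ × ℕ) × ℕ => (⟨(((c.1.2 : ℤ) * c.2 - a₁) / q₁).toNat, c.1⟩ : Σ _ : ℕ, ℕ × ℕ)) ?_ ?_
  · -- the weight bound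
    rintro ⟨⟨d₀, d₁⟩, m⟩ hmem -
    simp only [Finset.mem_product, Finset.mem_Icc] at hmem
    obtain ⟨⟨⟨hd₀1, hd₀X⟩, hd₁1, hd₁X⟩, -, -⟩ := hmem
    exact abs_moebius_log_mul_le hd₀1 hd₀X hd₁1 hd₁X
  · -- the change of variables lands in the divisor pairs
    rintro ⟨⟨d₀, d₁⟩, m⟩ hmem ⟨hC1, ⟨hn1, _hnx⟩, ⟨hC2p, hC2⟩, _hWlo, hWhi, hC5lo, _hC5hi⟩
    simp only [Finset.mem_product, Finset.mem_Icc] at hmem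
    obtain ⟨⟨⟨_hd₀1, _hd₀X⟩, hd₁1, _hd₁X⟩, _hm1, hmM⟩ := hmem
    dsimp only at hC1 hn1 hC2p hC2 hWhi hC5lo ⊢
    set n : ℤ := ((d₁ : ℤ) * m - a₁) / q₁ with hn
    have hqn : q₁ * n = (d₁ : ℤ) * m - a₁ :=
      Int.mul_ediv_cancel' (Int.dvd_of_emod_eq_zero hC1)
    have hn0 : 0 ≤ n := by omega
    have hk : ((n.toNat : ℕ) : ℤ) = n := Int.toNat_of_nonneg hn0
    have hA : (((q₀ * n + a₀).toNat : ℕ) : ℤ) = q₀ * n + a₀ := Int.toNat_of_nonneg (by omega)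
    have hB : (q₁ * n + a₁).toNat = d₁ * m := by
      have e : q₁ * n + a₁ = ((d₁ * m : ℕ) : ℤ) := by push_cast; omega
      rw [e, Int.toNat_natCast]
    rw [htS]
    simp only [Finset.mem_sigma, Finset.mem_Icc, Finset.mem_product, Nat.mem_divisors, hk]
    refine ⟨⟨by omega, ?_⟩, ⟨?_, by omega⟩, ⟨?_, ?_⟩⟩
    · -- `n ≤ N`
      have hd₁pos : (0 : ℝ) < d₁ := by exact_mod_cast hd₁1
      have h1 : (d₁ : ℝ) * (x : ℝ) ^ σ₁ < (x : ℝ) ^ (1 + θ) :=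
        calc (d₁ : ℝ) * (x : ℝ) ^ σ₁ < d₁ * d₀ := mul_lt_mul_of_pos_left hC5lo hd₁pos
          _ = d₀ * d₁ := mul_comm _ _
          _ ≤ (x : ℝ) ^ (1 + θ) := hWhi
      have h2 : (d₁ : ℝ) < (x : ℝ) ^ (1 + θ - σ₁) := by
        rw [Real.rpow_sub hxpos, lt_div_iff₀ hxσ]
        exact h1
      have hM : (m : ℝ) ≤ M₀ := by exact_mod_cast hmM
      have h3 : (d₁ : ℝ) * m ≤ (M₀ : ℝ) * (x : ℝ) ^ (1 + θ - σ₁) :=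
        calc (d₁ : ℝ) * m ≤ d₁ * M₀ := mul_le_mul_of_nonneg_left hM hd₁pos.le
          _ ≤ (x : ℝ) ^ (1 + θ - σ₁) * M₀ := mul_le_mul_of_nonneg_right h2.le (Nat.cast_nonneg _)
          _ = (M₀ : ℝ) * (x : ℝ) ^ (1 + θ - σ₁) := mul_comm _ _
      have h4 : n ≤ (d₁ : ℤ) * m + |a₁| := by
        have : n ≤ q₁ * n := le_mul_of_one_le_left hn0 (by omega)
        have : -a₁ ≤ |a₁| := neg_le_abs a₁
        omega
      have h5 : (n : ℝ) ≤ (M₀ : ℝ) * (x : ℝ) ^ (1 + θ - σ₁) + |(a₁ : ℝ)| := by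
        have : (n : ℝ) ≤ (d₁ : ℝ) * m + |(a₁ : ℝ)| := by exact_mod_cast h4
        linarith
      by_cases hle : a₁.natAbs ≤ n.toNat
      · have h6 : (((n.toNat - a₁.natAbs : ℕ) : ℕ) : ℝ) ≤ (M₀ : ℝ) * (x : ℝ) ^ (1 + θ - σ₁) := by
          rw [Nat.cast_sub hle]
          have e1 : ((n.toNat : ℕ) : ℝ) = (n : ℝ) := by exact_mod_cast hk
          have e2 : ((a₁.natAbs : ℕ) : ℝ) = |(a₁ : ℝ)| := by
            rw [Nat.cast_natAbs, Int.cast_abs]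
          linarith
        have h7 := Nat.le_floor h6
        omega
      · omega
    · -- `d₀ ∣ (q₀ n + a₀)⁺`
      rw [← Int.natCast_dvd_natCast, hA]
      exact hC2
    · -- `d₁ ∣ (q₁ n + a₁)⁺ = d₁ m`
      rw [hB]
      exact dvd_mul_right d₁ m
    · rw [hB]
      exact Nat.mul_ne_zero (by omega) (by omega)
  · -- the change of variables is injective on TRUE configurations
    rintro ⟨⟨d₀, d₁⟩, m⟩ hmem ⟨hC1, ⟨hn1, -⟩, -⟩ ⟨⟨d₀', d₁'⟩, m'⟩ - ⟨hC1', ⟨hn1', -⟩, -⟩ heq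
    simp only [Finset.mem_product, Finset.mem_Icc] at hmem
    obtain ⟨⟨-, hd₁1, -⟩, -, -⟩ := hmem
    dsimp only at hC1 hn1 hC1' hn1' heq
    simp only [Sigma.mk.inj_iff, heq_eq_eq, Prod.mk.injEq] at heq
    obtain ⟨hnn, rfl, rfl⟩ := heq
    have hqn : q₁ * (((d₁ : ℤ) * m - a₁) / q₁) = (d₁ : ℤ) * m - a₁ :=
      Int.mul_ediv_cancel' (Int.dvd_of_emod_eq_zero hC1)
    have hqn' : q₁ * (((d₁ : ℤ) * m' - a₁) / q₁) = (d₁ : ℤ) * m' - a₁ :=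
      Int.mul_ediv_cancel' (Int.dvd_of_emod_eq_zero hC1')
    have hnn' : ((d₁ : ℤ) * m - a₁) / q₁ = ((d₁ : ℤ) * m' - a₁) / q₁ := by omega
    have hdm : (d₁ : ℤ) * m = (d₁ : ℤ) * m' := by
      linear_combination -hqn + hqn' + q₁ * hnn'
    have hd₁ne : (d₁ : ℤ) ≠ 0 := by exact_mod_cast (show d₁ ≠ 0 by omega)
    have hmm' : (m : ℤ) = m' := mul_left_cancel₀ hd₁ne hdm
    have hmeq : m = m' := by exact_mod_cast hmm'
    subst hmeq
    rfl

end Summit.Parity.BatemanHorn.Theorems.PolyMobiusTail.EtaFreeWindow
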